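/-
Copyright (c) 2026. All rights reserved.
Released under Apache 2.0 license as described in the file LICENSE.
Authors: abc-iut cell, prover seat abc-iut-L4-d2 (gen 7).
-/
import Mathlib.Algebra.Category.Ring.Basic
import Literature.AnabelianGeometry.AbsoluteAnabelian.GaloisTheatersNumberFieldShadowPanalocal
import Literature.AnabelianGeometry.AbsoluteAnabelian.TPairs
import HarnessLib

/-!
# [AbsTopIII] Def 5.1 (v) at the number-field shadow context, `T = TF`: the `TF`-pair vocabulary with GENUINE field data `ℚ̄`
# and GENUINE archimedean Kummer structures

S. Mochizuki, *Topics in absolute anabelian geometry III* [MochizukiAbsTopIII2015], Def 5.1 (ii) p. 114 ("the completion of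
`k_NF(Π_X)` at `v ∈ V(Π_X)` by `k_NF(Π_X, v)`"; "`κ_{ell,v} : k_NF(Π_X) ↪ A_{X_{ell,v}}`"), Def 5.1 (v) pp. 116–117 (global
`T`-pairs; p. 116: "If `T = TF`, then let `T⊚ := T`"; pp. 116–117: "let us write `M_{T⊚}(Π)` for the object of `T⊚`, equipped
with a continuous action by `Π`, determined by `k_NF(Π)` [if `T⊚ = TF`]"; p. 117: "let us write `M_T(Π, v)` for the object of `T`,
equipped with a continuous action by the decomposition group `Π_v ⊆ Π` of `v`, determined by `k_NF(Π, v)` [if `T⊚ = TF`]";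
reference conditions (a)–(d)), Def 4.1 (i) p. 101 (gloss: a Kummer structure on `M` is an injection `κ_M : M ↪ A_X`),
Cor 5.2 (iii)/(iv) pp. 119–120.  (v2: the three Def 5.1 (v) fragments re-quoted verbatim — referee abc-iut-ref-l L14-n5 site 1;
declarations byte-identical to v1 p491073.)

The cell typed the `T`-pair language as the INTERFACE `TPairVocabulary R T` (`TPairs.lean`, abc-iut-L4-t3).  Genuine-data
vocabularies so far: the `TM`-shadow `NumberFieldShadow.shadowVocabulary` (abc-iut-L4-d2 g6: global datum `ℚ̄ˣ`, STUB Kummer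
structures) — at which Cor 5.2 (iii) (`ReferencePairIsoUnique` F-0189, `TPairHomDeterminedByTheaterHom` F-0191) is FALSE
(inversion of `ℚ̄ˣ` is an equivariant automorphism; stub Kummer structures pin nothing).

THIS DEF-BEARING FILE builds, over `NumberFieldShadow.context F`, the **`TF`-pair vocabulary**, whose data are RIGID:

* `T = T⊚ = TF` modelled by Mathlib's `CommRingCat` (the objects that occur are fields; `(−)^{T⊚} := 𝟭`);
* `M_{TF}(Π_E) := ℚ̄ = k_NF(Π_E)` (GENUINE) with `Π_E` acting by field automorphisms through its `ℚ`-chart (`fieldAutHom`,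
  `fieldGlobAct`); `M_TF(Π_E, v) := ℚ̄`, the ALGEBRAIC PART of print's completion `k_NF(Π, v)`, with the decomposition group
  `Π_{E,v}` acting likewise, and `ρ_v := 𝟙` (= `k_NF ↪ k_NF(Π, v)` on the algebraic part) — HONEST SIMPLIFICATION: the completion
  and its topology are not modelled;
* continuity predicates = "stabilisers are open"; `IsMLFGaloisPair (D ↷ M) :=` "`D` is of MLF-Galois type" (the group-theoretic
  half of Def 3.1 (ii) only — HONEST PARTIAL, as in the `TM`-shadow);
* **GENUINE archimedean Kummer structures** (Def 4.1 (i)): `KummerStr X M := (M →+* A_X)` (ring homomorphisms — from a field they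
  are injective), transport along `(i : X ≅ Y, ψ : M ≅ N)` := `i_A ∘ κ ∘ ψ⁻¹`, `IsAutHolPair κ := Injective κ`, and the canonical
  Kummer structure of `(X(Π, v) ↶κ M_TF(Π, v))` IS the context's complex embedding `κ_{ell,v} : ℚ̄ ↪ ℂ = A_{X(Π,v)}`;
* cyclotomes and `ZIndex`: STUBS (no cyclotomic content; Cor 5.2 (ii) is not addressed here);
* `fieldShadowVocabulary F : TPairVocabulary (context F) .TF`, `tf_ne_tlg : TF ≠ TLG`, and the canonical global `TF`-pair
  `fieldShadowGlobalTPair F : GlobalTPair (fieldShadowVocabulary F)` at `E_F` (the vocabulary is INHABITED).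

The point (proof-only sequels): at this vocabulary Cor 5.2 (iii) F-0189 / F-0191 HOLD — the global datum is pinned by slimness
of `G_ℚ`, the nonarchimedean data by RELATIVE slimness of decomposition groups ([AbsAnab] Thm 1.1.1 (ii), proved in the tree),
the archimedean data by injectivity of `κ_v` — and Cor 5.2 (iv) F-0190 / F-0192 hold as for the `TM`-shadow.
HONEST LABEL: shadow (`Δ = 1`), genuine global/local FIELD data (algebraic parts), genuine archimedean Kummer embeddings, stub
cyclotomes; NOT print's `T`-pairs of an elliptically admissible curve (E-L4-13).  No `instance`/`notation`/attribute
changes; nothing here bears on [IUTchIII] Cor. 3.12 or takes a side; typed ≠ proved.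
-/

noncomputable section

open scoped Pointwise Topology
open CategoryTheory NumberField Field

namespace Literature.AnabelianGeometry.AbsoluteAnabelian

namespace NumberFieldShadow

/-! ### The Galois action on `ℚ̄` in `CommRingCat` -/

/-- **`G_ℚ ↷ ℚ̄` in `CommRingCat`**: the genuine Galois action on `k_NF = ℚ̄` by field automorphisms, as a homomorphism
`G_ℚ →* Aut(ℚ̄)`. [cite: MochizukiAbsTopIII2015, Def 5.1 (v) p.117] -/
def fieldAutHom : absoluteGaloisGroup ℚ →* Aut (CommRingCat.of (AlgebraicClosure ℚ)) where
  toFun σ := (absoluteGaloisGroup.toAlgEquiv ℚ σ).toRingEquiv.toCommRingCatIso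
  map_one' := by
    ext x
    rfl
  map_mul' σ τ := by
    ext x
    rfl

/-- Unfolding: `fieldAutHom σ` acts by `σ • −`. [cite: MochizukiAbsTopIII2015, Def 5.1 (v) p.117] -/
theorem fieldAutHom_hom_apply (σ : absoluteGaloisGroup ℚ) (x : AlgebraicClosure ℚ) :
    (fieldAutHom σ).hom.hom x = σ • x := rfl

/-- Unfolding, inverse direction: `(fieldAutHom σ)⁻¹` acts by `σ⁻¹ • −`. [cite: MochizukiAbsTopIII2015, Def 5.1 (v) p.117] -/
theorem fieldAutHom_inv_apply (σ : absoluteGaloisGroup ℚ) (x : AlgebraicClosure ℚ) :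
    (fieldAutHom σ).inv.hom x = σ⁻¹ • x := rfl

/-- `M_{TF}(Π_E) = ℚ̄` with `Π_E` acting through its `ℚ`-chart. [cite: MochizukiAbsTopIII2015, Def 5.1 (v) p.117] -/
def fieldGlobAct (E : FundamentalExtension.{0}) : E.arith →* Aut (CommRingCat.of (AlgebraicClosure ℚ)) :=
  fieldAutHom.comp (ratChart E).toMonoidHom

/-- Unfolding: `g ∈ Π_E` acts on `ℚ̄` by `ratChart E g • −`. [cite: MochizukiAbsTopIII2015, Def 5.1 (v) p.117] -/
theorem fieldGlobAct_hom_apply (E : FundamentalExtension.{0}) (g : E.arith) (x : AlgebraicClosure ℚ) :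
    (fieldGlobAct E g).hom.hom x = ratChart E g • x := rfl

/-- `Π_v ↷ M_TF(Π_E, v) := ℚ̄` (the decomposition group acting through the chart on the algebraic part of `k_NF(Π, v)`).
[cite: MochizukiAbsTopIII2015, Def 5.1 (v) p.117] -/
def fieldLocAct (E : FundamentalExtension.{0}) (v : (contextProVal E).carrier) :
    (contextProVal E).decompGrp v →* Aut (CommRingCat.of (AlgebraicClosure ℚ)) :=
  (fieldGlobAct E).comp ((contextProVal E).decomp v).subtype

/-- Unfolding: `g ∈ Π_{E,v}` acts on `ℚ̄` by `ratChart E g • −`. [cite: MochizukiAbsTopIII2015, Def 5.1 (v) p.117] -/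
theorem fieldLocAct_hom_apply (E : FundamentalExtension.{0}) (v : (contextProVal E).carrier)
    (g : (contextProVal E).decompGrp v) (x : AlgebraicClosure ℚ) :
    (fieldLocAct E v g).hom.hom x = ratChart E g.1 • x := rfl

/-! ### Archimedean Kummer structures: field embeddings into `A_X` -/

/-- **Transport of a Kummer structure** `κ : M ↪ A_X` along an isomorphism of Aut-holomorphic orbispaces `i : X ≅ Y` and
an isomorphism `ψ : M ≅ N` of `TF`: `i_A ∘ κ ∘ ψ⁻¹ : N ↪ A_Y` (Def 4.1 (i): a Kummer structure is an injection into `A_X`;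
morphisms of Aut-holomorphic pairs transport them). [cite: MochizukiAbsTopIII2015, Def 4.1 (i) p.101] -/
def kummerTransportTF {X Y : AutHolOrbispace.{0}} {M N : CommRingCat.{0}} (i : AutHolOrbispace.Iso X Y) (ψ : M ≅ N)
    (κ : M →+* X.fieldA) : N →+* Y.fieldA :=
  i.fieldIso.toRingHom.comp (κ.comp ψ.inv.hom)

/-- Unfolding. [cite: MochizukiAbsTopIII2015, Def 4.1 (i) p.101] -/
theorem kummerTransportTF_apply {X Y : AutHolOrbispace.{0}} {M N : CommRingCat.{0}} (i : AutHolOrbispace.Iso X Y)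
    (ψ : M ≅ N) (κ : M →+* X.fieldA) (n : N) :
    kummerTransportTF i ψ κ n = i.fieldIso (κ (ψ.inv.hom n)) := rfl

/-- Transport along identities is the identity. [cite: MochizukiAbsTopIII2015, Def 4.1 (i) p.101] -/
theorem kummerTransportTF_refl {X : AutHolOrbispace.{0}} {M : CommRingCat.{0}} (κ : M →+* X.fieldA) :
    kummerTransportTF ⟨Homeomorph.refl _, RingEquiv.refl _, ContinuousMulEquiv.refl _⟩ (Iso.refl M) κ = κ :=
  RingHom.ext fun _ => rfl

variable (F : Type) [Field F] [NumberField F]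

/-! ### The vocabulary -/

/-- **The `TF`-pair vocabulary of the number-field shadow** over `NumberFieldShadow.context F`: `T = T⊚ :=` commutative rings
(`CommRingCat`; the data are fields), `M_{TF}(Π) := ℚ̄` with the GENUINE Galois action through the `ℚ`-chart, local data `:= ℚ̄`
(algebraic part of the completion) with the decomposition-group action and `ρ_v := 𝟙`, continuity = open stabilisers,
`IsMLFGaloisPair :=` "the group is of MLF-Galois type" (partial), Kummer structures = field embeddings `M ↪ A_X` with the
GENUINE `κ_{ell,v}` as canonical datum, cyclotomes / `ZIndex` = STUBS. [cite: MochizukiAbsTopIII2015, Def 5.1 (v) p.117] -/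
def fieldShadowVocabulary : TPairVocabulary (context F) .TF where
  LocObj := CommRingCat.{0}
  GlobObj := CommRingCat.{0}
  toGlob := 𝟭 CommRingCat.{0}
  IsContLoc := fun {D} {M} act => ∀ m : M, ∃ U : OpenSubgroup D, ∀ u : D, u ∈ U → (act u).hom.hom m = m
  IsContGlob := fun {P} {M} act => ∀ m : M, ∃ U : OpenSubgroup P, ∀ u : P, u ∈ U → (act u).hom.hom m = m
  IsMLFGaloisPair := fun {D} {_} _ => IsMLFGaloisType D
  KummerStr := fun X M => ((M : Type) →+* X.fieldA)
  IsAutHolPair := fun κ => Function.Injective κ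
  kummerTransport := fun i ψ κ => kummerTransportTF i ψ κ
  kummerTransport_refl := fun κ => kummerTransportTF_refl κ
  globData := fun _ => CommRingCat.of (AlgebraicClosure ℚ)
  globAct := fieldGlobAct
  locDataNon := fun _ _ => CommRingCat.of (AlgebraicClosure ℚ)
  locDataArc := fun _ _ => CommRingCat.of (AlgebraicClosure ℚ)
  locAct := fun E v => fieldLocAct E v.1
  locKummer := fun E v => contextKappa E v
  locRestrictNon := fun _ _ => 𝟙 _
  locRestrictArc := fun _ _ => 𝟙 _
  cyclotome := fun _ => ProfiniteGrp.of PUnit.{1}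
  cyclotomeGrp := fun _ => ProfiniteGrp.of PUnit.{1}
  IsCyclotomeCompatible := fun _ _ => True
  IsCyclotomeArchCompatible := fun _ _ => True
  ZIndex := PEmpty.{1}
  IsGeomIsoTo := fun z _ => z.elim

/-- `TF ≠ TLG` — the side condition of the Cor 5.2 (iii)/(iv) rows at `T = TF`. [cite: MochizukiAbsTopIII2015, Cor 5.2 (iii) p.119] -/
theorem tf_ne_tlg : TKind.TF ≠ TKind.TLG := fun h => TKind.noConfusion h

/-- The global datum of the `TF`-shadow vocabulary is the field `ℚ̄`. [cite: MochizukiAbsTopIII2015, Def 5.1 (v) p.117] -/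
theorem fieldShadowVocabulary_globData (E : FundamentalExtension.{0}) :
    (fieldShadowVocabulary F).globData E = CommRingCat.of (AlgebraicClosure ℚ) := rfl

/-- Its action is the chart action by field automorphisms. [cite: MochizukiAbsTopIII2015, Def 5.1 (v) p.117] -/
theorem fieldShadowVocabulary_globAct (E : FundamentalExtension.{0}) :
    (fieldShadowVocabulary F).globAct E = fieldGlobAct E := rfl

/-- The canonical archimedean Kummer structure is the context's complex embedding `κ_{ell,v}`.
[cite: MochizukiAbsTopIII2015, Def 5.1 (v) p.117] -/
theorem fieldShadowVocabulary_locKummer (E : FundamentalExtension.{0}) (v : (contextProVal E).arc) :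
    (fieldShadowVocabulary F).locKummer E v = contextKappa E v := rfl

/-! ### Non-vacuity: the canonical global `TF`-pair over the shadow -/

/-- The chart action `Π_E ↷ ℚ̄` has open stabilisers (continuity for the discrete topology on the algebraic part).
[cite: MochizukiAbsTopIII2015, Def 5.1 (v) p.117] -/
theorem isContGlob_fieldGlobAct (E : FundamentalExtension.{0}) :
    (fieldShadowVocabulary F).IsContGlob ((fieldShadowVocabulary F).globAct E) := by
  show ∀ x : AlgebraicClosure ℚ, ∃ U : OpenSubgroup E.arith, ∀ u : E.arith, u ∈ U → ratChart E u • x = x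
  intro x
  have hopen : IsOpen {σ : absoluteGaloisGroup ℚ | σ • x = x} :=
    NumberFieldValuationProSet.isOpen_preimage_smul_singleton ℚ _ _
  exact ⟨⟨(MulAction.stabilizer (absoluteGaloisGroup ℚ) x).comap (ratChart E).toMonoidHom,
    hopen.preimage (ratChart E).continuous⟩, fun u hu => hu⟩

/-- The local pairs `(Π_v ↷ ℚ̄)` of the shadow satisfy the vocabulary's MLF-Galois-pair predicate (`Π_v` is of MLF-Galois
type, `isMLFGaloisType_decomp_context`) at admissible `Π_E`. [cite: MochizukiAbsTopIII2015, Def 5.1 (v) p.117] -/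
theorem isMLFGaloisPair_fieldLocAct {E : FundamentalExtension.{0}} (hE : IsAdmissible F E)
    (v : ((context F).proVal E).non) :
    (fieldShadowVocabulary F).IsMLFGaloisPair ((fieldShadowVocabulary F).locAct E v) :=
  isMLFGaloisType_decomp_context F hE v.1 v.2 _

/-- The canonical archimedean Kummer structures `κ_{ell,v} : ℚ̄ ↪ ℂ` are injective, i.e. `(X(Π,v) ↶κ ℚ̄)` satisfies the
vocabulary's Aut-holomorphic-pair predicate. [cite: MochizukiAbsTopIII2015, Def 4.1 (i) p.101] -/
theorem isAutHolPair_locKummer (E : FundamentalExtension.{0}) (v : ((context F).proVal E).arc) :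
    (fieldShadowVocabulary F).IsAutHolPair ((fieldShadowVocabulary F).locKummer E v) :=
  (contextKappa E v).injective

/-- **The canonical global `TF`-pair `M⊚_TF(E_F)` over the shadow vocabulary** (Cor 5.2 (iv), object map at `E_F`): global
`TF`-pairs over the shadow EXIST. [cite: MochizukiAbsTopIII2015, Cor 5.2 (iv) p.120] -/
def fieldShadowGlobalTPair : GlobalTPair (fieldShadowVocabulary F) :=
  (fieldShadowVocabulary F).canonical (extension F) (isAdmissible_extension F) (isContGlob_fieldGlobAct F _)
    (fun v => isMLFGaloisPair_fieldLocAct F (isAdmissible_extension F) v) (fun v => isAutHolPair_locKummer F _ v)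

/-- Global `TF`-pairs over the shadow vocabulary exist. [cite: MochizukiAbsTopIII2015, Cor 5.2 (iv) p.120] -/
theorem nonempty_globalTPair_fieldShadow : Nonempty (GlobalTPair (fieldShadowVocabulary F)) :=
  ⟨fieldShadowGlobalTPair F⟩

end NumberFieldShadow

end Literature.AnabelianGeometry.AbsoluteAnabelian

end
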